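import Literature.MathematicalPhysics.QuantumFieldTheory.Balaban1983to89.B9RWSumsDefinitePinsPairM
import Literature.MathematicalPhysics.QuantumFieldTheory.Balaban1983to89.B9GeoNbrCountKLevelV1

/-!
# BalabanUVNodes ∕ N06 ([B9], `Dag.B9_main`) — THE NUMERIC SIDE CONDITIONS OF THE STAGE-11 CERTIFICATE (EDITION 25) ARE JOINTLY SATISFIABLE:
# a kernel witness for all 63 pure-numeric hypotheses of `…N06AtOpsYNuOfRecordV6EPairNF.b9_main_of_up_view₁₁B10YZW_opsYNuOfRecordV6E_pairNF`

Track A of `YM-PLAN.md` (cell `pub-ymgap`, HUMAN RULING D-0062), node **N06** = [Balaban1985BackgroundPropagators] Thms 3.1–3.15; seat `pub-ymgap-dag-n06-d`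
(gen 10).  A REFEREE AID (A6 on the numerics), not a certificate edition.

WHAT.  The certificate of record (edition 25, p602838) is universally quantified over 13 groups of numerics (`Mstar`, `α' r39 δ39 B39 a39 M39`, `a311 M311`,
the pin primitives `p q : PinPrims`, `p3 q3 : PairPrims`, `pM qM : MixedPrims`, rows 20–21's `δ12₀ δK12 σ12 ρ12 a12 M12 B12₃ δ12₃ ρ13 α12`, `θ2₁₂ ρf12 Bq12`,
`t12 δT12 ρS σS`, `B13₄ θV13 Br13 BhD13 Bx13 Bd13 Bd2₁₃`, `tJ δB rT`, `Bx0 BdX BiD (BdD)`, `a₀E δ₁E B₁E`) under 63 pure-numeric hypotheses — signs, the `.OK`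
clauses, the two `nbrM₀Y` thresholds on `M⋆`, and, since edition 25, ONE COUPLED CHAIN: the rate cascade of rows 20–21 hangs below the CLOSED (3.49) rate
`min ((1−2p.α)p.δ₀) δ39 ∕ 8` — `hδKS : δK12 + q.αF·δF_q ≤ ρS`, `hρST : ρS ≤ δT12`, `hδTr : δT12 + 2σS + 3·q.αF·δF_q ≤ rT`, `hrTP : rT ≤ min(δF_p, δ39)∕8`,
`hσSK : σS ≤ δK12`, `hρδ12 : ρ12 + σ12 ≤ δK12`, `hρS₀ : ρS + σS ≤ δ12₀ ≤ (1−3q.αF)δF_q` (δF_p := (1−2p.α)p.δ₀, δF_q := (1−2q.α)q.δ₀).  An A6 question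
(«is the hypothesis set inhabited?») has a numeric half: could the 63 side conditions be contradictory, making the certificate vacuous on arithmetic grounds?
★ `numerics_inhabited_ed25` answers NO with explicit values (p.α = q.α = 1∕4, p.δ₀ = q.δ₀ = 1, q.αF = 10⁻³, δ39 = 1, rT = 1∕16, δT12 = 1∕20, ρS = 1∕25,
δK12 = 1∕50, σS = σ12 = ρf12 = 10⁻³, ρ12 = 10⁻², ρ13 = 1∕200, α12 = 1∕8, δ12₀ = 9∕20, δ12₃ = 1, all sizes 0 or 1, all leg functions 0,
`M⋆ = max (nbrM₀Y … 2) (nbrM₀Y … (ℓ+4))`), the hypotheses listed VERBATIM in the certificate's order (the binders `κ13` (`hκ13 ∕ hκW13`) and `r14` (`hr14`) bound LETTERS, not numerics, and `BdD` carries no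
hypothesis — these three are not part of this list).
HONEST FRAMING.  Arithmetic only; says nothing about the inhabitation of the displayed SCHEMAS at these numerics (the node's content); COUNT-NEUTRAL; N06 NOT
discharged.  One finite 𝕋⁴ programme at fixed `ε` — NOT continuum, NOT OS, NOT the mass gap ∕ Clay.  0 `def`, 0 `sorry`.
-/

noncomputable section

namespace Summit.QuantumFields.YangMills.BalabanUVNodes.N06NumericsWitness

open Literature.MathematicalPhysics.QuantumFieldTheory.Balaban1983to89
open Literature.MathematicalPhysics.QuantumFieldTheory.Balaban1983to89.B9RWSumsDefinitePins (PinPrims)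
open Literature.MathematicalPhysics.QuantumFieldTheory.Balaban1983to89.B9RWSumsDefinitePinsPair (PairPrims)
open Literature.MathematicalPhysics.QuantumFieldTheory.Balaban1983to89.B9RWSumsDefinitePinsPairM (MixedPrims)
open Literature.MathematicalPhysics.QuantumFieldTheory.Balaban1983to89.B9GeoNbrCountKLevelV1 (nbrM₀Y)

/-- ★ **THE 63 PURE-NUMERIC HYPOTHESES OF EDITION 25 ARE JOINTLY SATISFIABLE** (module docstring) — for every member geometry `(d, ℓ, hd, hL, b₀, b₁)` there are
numerics meeting all of them, listed verbatim in the certificate's order. [cite: Balaban1985BackgroundPropagators, Thm 3.1 p.397 («a positive constant δ₀»), (3.49) p.399, pp.423–424 («δ₀, B₀ redefined as the common best constants»); Balaban1984PropagatorsII, Lemma 2.1 p.234] -/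
theorem numerics_inhabited_ed25 (d ℓ : ℕ) (hd : 1 ≤ d + 1) (hL : Odd (ℓ + 1) ∧ 1 < ℓ + 1) (b₀ b₁ : ℝ) :
    ∃ (Mstar : ℕ) (α' r39 δ39 B39 a39 M39 a311 M311 : ℝ) (p q : PinPrims) (p3 q3 : PairPrims) (pM qM : MixedPrims)
      (δ12₀ δK12 σ12 ρ12 a12 M12 B12₃ δ12₃ ρ13 α12 θ2₁₂ ρf12 : ℝ) (Bq12 : ℝ → ℝ) (t12 δT12 ρS σS B13₄ : ℝ)
      (θV13 Br13 BhD13 Bx13 Bd13 : ℝ → ℝ) (Bd2₁₃ : ℝ → ℝ → ℝ) (tJ δB rT : ℝ) (Bx0 BdX BiD : ℝ → ℝ) (a₀E δ₁E B₁E : ℝ),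
      (0 < α') ∧ (α' < 1) ∧ (0 < r39) ∧ (r39 ≤ δ39) ∧ (0 < B39) ∧ (0 < a39) ∧ (0 < M39) ∧ (0 < a311) ∧ (0 < M311) ∧
      p.OK ∧ q.OK ∧ p3.OK ∧ q3.OK ∧ pM.OK ∧ qM.OK ∧
      (nbrM₀Y d ℓ hd hL b₀ b₁ 2 ≤ Mstar) ∧ (nbrM₀Y d ℓ hd hL b₀ b₁ ((ℓ : ℝ) + 4) ≤ Mstar) ∧
      (0 ≤ θ2₁₂) ∧ (0 < ρf12) ∧ (ρf12 + σ12 ≤ (1 - α12) * ρ12) ∧ (ρf12 + 2 * σ12 + α12 * ρ12 ≤ ρ12) ∧ (∀ β, 0 ≤ Bq12 β) ∧ (0 ≤ B12₃) ∧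
      (0 < σ12) ∧ (0 < ρ12) ∧ (ρ12 ≤ δ12₀) ∧ (ρ12 + σ12 ≤ δK12) ∧ (ρ12 + σ12 ≤ δ12₃) ∧ (0 < a12) ∧ (0 < M12) ∧ (0 < α12) ∧ (α12 ≤ 1 / 2) ∧
      (δ12₀ ≤ (1 - 3 * q.αF) * ((1 - 2 * q.α) * q.δ₀)) ∧
      (0 ≤ t12) ∧ (0 < σS) ∧ (ρS ≤ δT12) ∧ (ρS + σS ≤ δ12₀) ∧ (ρS + σS ≤ δ12₃) ∧ (δK12 + q.αF * ((1 - 2 * q.α) * q.δ₀) ≤ ρS) ∧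
      (M311 ≤ M12) ∧ (a12 ≤ a311) ∧ (σS ≤ δK12) ∧ (0 < ρ13) ∧ (ρ13 + 5 * σ12 ≤ ρ12) ∧ (3 * σ12 < (1 - α12) * ρ13) ∧
      (∀ ε, 0 < ε → 0 ≤ θV13 ε) ∧ (0 ≤ B13₄) ∧ (∀ ε, 0 < ε → 0 ≤ Br13 ε) ∧ (∀ β, 0 ≤ β → β < 1 → 0 ≤ BhD13 β) ∧
      (∀ β, 0 ≤ β → β < 1 → 0 ≤ Bx13 β) ∧ (∀ ε, 0 < ε → ε ≤ 1 → 0 ≤ Bd13 ε) ∧ (∀ ε β, 0 < ε → ε ≤ 1 → 0 ≤ β → β < 1 → 0 ≤ Bd2₁₃ ε β) ∧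
      (0 ≤ tJ) ∧ (rT ≤ min ((1 - 2 * p.α) * p.δ₀) δ39 / 8) ∧ (rT ≤ δB) ∧ (0 ≤ δT12) ∧ (δT12 + 2 * σS + 3 * (q.αF * ((1 - 2 * q.α) * q.δ₀)) ≤ rT) ∧
      (∀ β, 0 ≤ β → β < 1 → 0 ≤ Bx0 β) ∧ (∀ β, 0 ≤ β → β < 1 → 0 ≤ BdX β) ∧ (∀ ε, 0 < ε → 0 ≤ BiD ε) ∧
      (0 < a₀E) ∧ (0 < δ₁E) ∧ (0 < B₁E) := by
  -- one side's pin primitives: α = 1∕4, δ₀ = B₀ = a₁ = M₁ = C_ℓ = 1, α_F = 10⁻³, every count ∕ size 0, every leg function 0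
  let pp : PinPrims :=
    { α := 1 / 4, ρ := 0, Nc := 0, N' := 0, NF := 0, Cℓ := 1, Kc := 0, θ₀ := 0, B₀ := 1, δ₀ := 1, a₁ := 1, M₁ := 1, αF := 1 / 1000,
      NH := 0, NL := 0, BL := 0, NI := 0, N2 := 0, B2 := 0, θ2 := 0, Bl := fun _ => 0, Bt := fun _ => 0, BI := fun _ => 0, θI := fun _ => 0,
      BI2 := fun _ _ => 0 }
  have hpp : pp.OK :=
    { α_pos := by norm_num [pp], α_lt := by norm_num [pp], Nc_nn := le_rfl, N'_nn := le_rfl, NF_nn := le_rfl, one_le_Cℓ := le_rfl, Kc_nn := le_rfl,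
      θ₀_nn := le_rfl, B₀_pos := by norm_num [pp], δ₀_pos := by norm_num [pp], a₁_pos := by norm_num [pp], M₁_pos := by norm_num [pp],
      αF_pos := by norm_num [pp], αF_lt := by norm_num [pp], NH_nn := le_rfl, NL_nn := le_rfl, BL_nn := le_rfl, NI_nn := le_rfl, N2_nn := le_rfl,
      B2_nn := le_rfl, θ2_nn := le_rfl, Bl_nn := fun _ _ _ => le_rfl, Bt_nn := fun _ _ _ => le_rfl, BI_nn := fun _ _ _ => le_rfl,
      BI2_nn := fun _ _ _ _ _ _ => le_rfl, θI_nn := fun _ _ => le_rfl }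
  have hα : pp.α = 1 / 4 := rfl
  have hδ : pp.δ₀ = 1 := rfl
  have hF : pp.αF = 1 / 1000 := rfl
  refine ⟨max (nbrM₀Y d ℓ hd hL b₀ b₁ 2) (nbrM₀Y d ℓ hd hL b₀ b₁ ((ℓ : ℝ) + 4)),
    1 / 2, 1, 1, 1, 1, 1, 1, 1, pp, pp, ⟨0, 0, 0⟩, ⟨0, 0, 0⟩, ⟨0, 0, 0⟩, ⟨0, 0, 0⟩,
    9 / 20, 1 / 50, 1 / 1000, 1 / 100, 1, 1, 0, 1, 1 / 200, 1 / 8, 0, 1 / 1000, fun _ => 0, 0, 1 / 20, 1 / 25, 1 / 1000, 0,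
    fun _ => 0, fun _ => 0, fun _ => 0, fun _ => 0, fun _ => 0, fun _ _ => 0, 0, 1, 1 / 16, fun _ => 0, fun _ => 0, fun _ => 0, 1, 1, 1,
    by norm_num, by norm_num, by norm_num, by norm_num, by norm_num, by norm_num, by norm_num, by norm_num, by norm_num,
    hpp, hpp, ⟨le_rfl, le_rfl, le_rfl⟩, ⟨le_rfl, le_rfl, le_rfl⟩, ⟨le_rfl, le_rfl, le_rfl⟩, ⟨le_rfl, le_rfl, le_rfl⟩,
    le_max_left _ _, le_max_right _ _,
    le_rfl, by norm_num, by norm_num, by norm_num, fun _ => le_rfl, le_rfl,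
    by norm_num, by norm_num, by norm_num, by norm_num, by norm_num, by norm_num, by norm_num, by norm_num, by norm_num,
    ?_, le_rfl, by norm_num, by norm_num, by norm_num, by norm_num, ?_, le_rfl, le_rfl, by norm_num, by norm_num, by norm_num, by norm_num,
    fun _ _ => le_rfl, le_rfl, fun _ _ => le_rfl, fun _ _ _ => le_rfl, fun _ _ _ => le_rfl, fun _ _ _ => le_rfl, fun _ _ _ _ _ _ => le_rfl,
    le_rfl, ?_, by norm_num, by norm_num, ?_, fun _ _ _ => le_rfl, fun _ _ _ => le_rfl, fun _ _ => le_rfl,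
    by norm_num, by norm_num, by norm_num⟩
  · rw [hF, hα, hδ]; norm_num
  · rw [hF, hα, hδ]; norm_num
  · rw [hα, hδ, min_eq_left (by norm_num)]; norm_num
  · rw [hF, hα, hδ]; norm_num

/-! ## v1.1 (edition 29 `…V6EPairNJ`): the same census with `θ₂` for `θ2₁₂`, the budget `hδTr` at `3σS`, the free rate `δ₂` (`rT ≤ δ₂`) and the one new side condition `rT ≤ δ₄` at an ARBITRARY positive rate `δ₄`
(in the certificate `δ₄ = δ46 θ.d₆ θ.ℓ₆ θ.hd' θ.hL' θ.b₀ θ.b₁ M⋆ N c35Y c35Y_pos`, the named (3.46)₄ rate of `B9Eq346GradGpDivAtPinsL2Closed`, a positive real of unknown size) -/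

/-- ★ **THE PURE-NUMERIC HYPOTHESES OF EDITION 29 ARE JOINTLY SATISFIABLE BELOW EVERY POSITIVE RATE `δ₄`** — editions 28∕29 replaced `θ2₁₂` (`0 ≤ θ2₁₂`) by `θ₂` (`0 ≤ θ₂`),
moved the budget `hδTr` to `δT12 + 3σS + … ≤ rT`, added the free rate `δ₂` of `hD2L2` (`hrT2 : rT ≤ δ₂`) and `hrT4 : rT ≤ δ₄` with `δ₄` the named constant `δ46 …` (`0 < δ46`, `B9Eq346GradGpDivAtPinsL2Closed.δ46_pos`), whose SIZE is not on record; so the guard must hold for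
EVERY `δ₄ > 0`: for every member geometry and every `δ₄ > 0` there are numerics meeting all 63 conditions of `numerics_inhabited_ed25` (with `θ₂` for `θ2₁₂`, `3σS` for `2σS`) AND `rT ≤ δ₄ ∧ rT ≤ δ₂`.
WHY IT WORKS: at fixed `α`-type quantities (`α' α12 p.α q.α q.αF`) every condition is positively homogeneous of degree one in the rates
(`r39 δ39 p.δ₀ q.δ₀ δ12₀ δK12 σ12 ρ12 δ12₃ ρ13 ρf12 δT12 ρS σS δB rT`), so the edition-25 witness scaled by `s := min 1 δ₄` is a witness with `rT = δ₂ = s∕16 ≤ δ₄`.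
[cite: Balaban1985BackgroundPropagators, Thm 3.1 p.397 («a positive constant δ₀»), (3.46) p.398, (3.49) p.399, pp.423–424; Balaban1984PropagatorsII, Lemma 2.1 p.234] -/
theorem numerics_inhabited_ed29 (d ℓ : ℕ) (hd : 1 ≤ d + 1) (hL : Odd (ℓ + 1) ∧ 1 < ℓ + 1) (b₀ b₁ : ℝ) (δ₄ : ℝ) (hδ₄ : 0 < δ₄) :
    ∃ (Mstar : ℕ) (α' r39 δ39 B39 a39 M39 a311 M311 : ℝ) (p q : PinPrims) (p3 q3 : PairPrims) (pM qM : MixedPrims)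
      (δ12₀ δK12 σ12 ρ12 a12 M12 B12₃ δ12₃ ρ13 α12 θ₂ ρf12 : ℝ) (Bq12 : ℝ → ℝ) (t12 δT12 ρS σS B13₄ : ℝ)
      (θV13 Br13 BhD13 Bx13 Bd13 : ℝ → ℝ) (Bd2₁₃ : ℝ → ℝ → ℝ) (tJ δB rT δ₂ : ℝ) (Bx0 BdX BiD : ℝ → ℝ) (a₀E δ₁E B₁E : ℝ),
      (0 < α') ∧ (α' < 1) ∧ (0 < r39) ∧ (r39 ≤ δ39) ∧ (0 < B39) ∧ (0 < a39) ∧ (0 < M39) ∧ (0 < a311) ∧ (0 < M311) ∧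
      p.OK ∧ q.OK ∧ p3.OK ∧ q3.OK ∧ pM.OK ∧ qM.OK ∧
      (nbrM₀Y d ℓ hd hL b₀ b₁ 2 ≤ Mstar) ∧ (nbrM₀Y d ℓ hd hL b₀ b₁ ((ℓ : ℝ) + 4) ≤ Mstar) ∧
      (0 ≤ θ₂) ∧ (0 < ρf12) ∧ (ρf12 + σ12 ≤ (1 - α12) * ρ12) ∧ (ρf12 + 2 * σ12 + α12 * ρ12 ≤ ρ12) ∧ (∀ β, 0 ≤ Bq12 β) ∧ (0 ≤ B12₃) ∧
      (0 < σ12) ∧ (0 < ρ12) ∧ (ρ12 ≤ δ12₀) ∧ (ρ12 + σ12 ≤ δK12) ∧ (ρ12 + σ12 ≤ δ12₃) ∧ (0 < a12) ∧ (0 < M12) ∧ (0 < α12) ∧ (α12 ≤ 1 / 2) ∧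
      (δ12₀ ≤ (1 - 3 * q.αF) * ((1 - 2 * q.α) * q.δ₀)) ∧
      (0 ≤ t12) ∧ (0 < σS) ∧ (ρS ≤ δT12) ∧ (ρS + σS ≤ δ12₀) ∧ (ρS + σS ≤ δ12₃) ∧ (δK12 + q.αF * ((1 - 2 * q.α) * q.δ₀) ≤ ρS) ∧
      (M311 ≤ M12) ∧ (a12 ≤ a311) ∧ (σS ≤ δK12) ∧ (0 < ρ13) ∧ (ρ13 + 5 * σ12 ≤ ρ12) ∧ (3 * σ12 < (1 - α12) * ρ13) ∧
      (∀ ε, 0 < ε → 0 ≤ θV13 ε) ∧ (0 ≤ B13₄) ∧ (∀ ε, 0 < ε → 0 ≤ Br13 ε) ∧ (∀ β, 0 ≤ β → β < 1 → 0 ≤ BhD13 β) ∧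
      (∀ β, 0 ≤ β → β < 1 → 0 ≤ Bx13 β) ∧ (∀ ε, 0 < ε → ε ≤ 1 → 0 ≤ Bd13 ε) ∧ (∀ ε β, 0 < ε → ε ≤ 1 → 0 ≤ β → β < 1 → 0 ≤ Bd2₁₃ ε β) ∧
      (0 ≤ tJ) ∧ (rT ≤ min ((1 - 2 * p.α) * p.δ₀) δ39 / 8) ∧ (rT ≤ δB) ∧ (0 ≤ δT12) ∧ (δT12 + 3 * σS + 3 * (q.αF * ((1 - 2 * q.α) * q.δ₀)) ≤ rT) ∧
      (∀ β, 0 ≤ β → β < 1 → 0 ≤ Bx0 β) ∧ (∀ β, 0 ≤ β → β < 1 → 0 ≤ BdX β) ∧ (∀ ε, 0 < ε → 0 ≤ BiD ε) ∧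
      (0 < a₀E) ∧ (0 < δ₁E) ∧ (0 < B₁E) ∧ (rT ≤ δ₄) ∧ (rT ≤ δ₂) := by
  -- the scale: `s := min 1 δ₄`, `0 < s ≤ 1`, `s ≤ δ₄`; every rate of the edition-25 witness is multiplied by `s`
  set s : ℝ := min 1 δ₄ with hsdef
  have hs : 0 < s := lt_min one_pos hδ₄
  have hs4 : s ≤ δ₄ := min_le_right _ _
  let pp : PinPrims :=
    { α := 1 / 4, ρ := 0, Nc := 0, N' := 0, NF := 0, Cℓ := 1, Kc := 0, θ₀ := 0, B₀ := 1, δ₀ := s, a₁ := 1, M₁ := 1, αF := 1 / 1000,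
      NH := 0, NL := 0, BL := 0, NI := 0, N2 := 0, B2 := 0, θ2 := 0, Bl := fun _ => 0, Bt := fun _ => 0, BI := fun _ => 0, θI := fun _ => 0,
      BI2 := fun _ _ => 0 }
  have hpp : pp.OK :=
    { α_pos := by norm_num [pp], α_lt := by norm_num [pp], Nc_nn := le_rfl, N'_nn := le_rfl, NF_nn := le_rfl, one_le_Cℓ := le_rfl, Kc_nn := le_rfl,
      θ₀_nn := le_rfl, B₀_pos := by norm_num [pp], δ₀_pos := hs, a₁_pos := by norm_num [pp], M₁_pos := by norm_num [pp],
      αF_pos := by norm_num [pp], αF_lt := by norm_num [pp], NH_nn := le_rfl, NL_nn := le_rfl, BL_nn := le_rfl, NI_nn := le_rfl, N2_nn := le_rfl,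
      B2_nn := le_rfl, θ2_nn := le_rfl, Bl_nn := fun _ _ _ => le_rfl, Bt_nn := fun _ _ _ => le_rfl, BI_nn := fun _ _ _ => le_rfl,
      BI2_nn := fun _ _ _ _ _ _ => le_rfl, θI_nn := fun _ _ => le_rfl }
  have hα : pp.α = 1 / 4 := rfl
  have hδ : pp.δ₀ = s := rfl
  have hF : pp.αF = 1 / 1000 := rfl
  refine ⟨max (nbrM₀Y d ℓ hd hL b₀ b₁ 2) (nbrM₀Y d ℓ hd hL b₀ b₁ ((ℓ : ℝ) + 4)),
    1 / 2, s, s, 1, 1, 1, 1, 1, pp, pp, ⟨0, 0, 0⟩, ⟨0, 0, 0⟩, ⟨0, 0, 0⟩, ⟨0, 0, 0⟩,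
    9 * s / 20, s / 50, s / 1000, s / 100, 1, 1, 0, s, s / 200, 1 / 8, 0, s / 1000, fun _ => 0, 0, s / 20, s / 25, s / 1000, 0,
    fun _ => 0, fun _ => 0, fun _ => 0, fun _ => 0, fun _ => 0, fun _ _ => 0, 0, s, s / 16, s / 16, fun _ => 0, fun _ => 0, fun _ => 0, 1, 1, 1,
    by norm_num, by norm_num, hs, le_rfl, by norm_num, by norm_num, by norm_num, by norm_num, by norm_num,
    hpp, hpp, ⟨le_rfl, le_rfl, le_rfl⟩, ⟨le_rfl, le_rfl, le_rfl⟩, ⟨le_rfl, le_rfl, le_rfl⟩, ⟨le_rfl, le_rfl, le_rfl⟩,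
    le_max_left _ _, le_max_right _ _,
    le_rfl, by positivity, by linarith, by linarith, fun _ => le_rfl, le_rfl,
    by positivity, by positivity, by linarith, by linarith, by linarith, by norm_num, by norm_num, by norm_num, by norm_num,
    ?_, le_rfl, by positivity, by linarith, by linarith, by linarith, ?_, le_rfl, le_rfl, by linarith, by positivity, by linarith, by linarith,
    fun _ _ => le_rfl, le_rfl, fun _ _ => le_rfl, fun _ _ _ => le_rfl, fun _ _ _ => le_rfl, fun _ _ _ => le_rfl, fun _ _ _ _ _ _ => le_rfl,
    le_rfl, ?_, by linarith, by positivity, ?_, fun _ _ _ => le_rfl, fun _ _ _ => le_rfl, fun _ _ => le_rfl,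
    by norm_num, by norm_num, by norm_num, by linarith, le_rfl⟩
  · rw [hF, hα, hδ]; linarith
  · rw [hF, hα, hδ]; linarith
  · rw [hα, hδ, min_eq_left (by linarith)]; linarith
  · rw [hF, hα, hδ]; linarith


/-- ★ **EDITIONS 29∕30: `M⋆` BEFORE `δ₄`** (referee ref-A g28 READ-25 NIT-A6 on `numerics_inhabited_ed29`): the certificate's `hrT4 : rT ≤ δ46 … M⋆ …` names a rate that is a
TERM OF `M⋆` (`B9Eq346GradGpDivAtPinsL2Closed.δ46`, a `choose`-constant of dag-n06-w7's member-uniform (3.46)₄ theorem at the members of `M⋆`), so a guard usable as a black box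
must produce `M⋆` FIRST and only then meet an arbitrary `δ₄ > 0`: `∃ M⋆, ∀ δ₄ > 0, ∃ rates …, <the 63 + 2 pure-numeric hypotheses of editions 29∕30 in the certificate's order>`
(edition 30 changes no numeric binder: its `hD2sup` carries the same `θ₂ δ₂`).  Same witness as `numerics_inhabited_ed29` — `M⋆ := max (nbrM₀Y … 2) (nbrM₀Y … (ℓ+4))` is
independent of `δ₄`, every rate scaled by `s := min 1 δ₄`.  Instantiate with `δ₄ := δ46 d ℓ hd hL b₀ b₁ M⋆ N c35Y c35Y_pos` (`δ46_pos`).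
[cite: Balaban1985BackgroundPropagators, Thm 3.1 p.397 («a positive constant δ₀»), (3.46) p.398, (3.49) p.399, pp.423–424; Balaban1984PropagatorsII, Lemma 2.1 p.234] -/
theorem numerics_inhabited_ed29M (d ℓ : ℕ) (hd : 1 ≤ d + 1) (hL : Odd (ℓ + 1) ∧ 1 < ℓ + 1) (b₀ b₁ : ℝ) :
    ∃ Mstar : ℕ, ∀ δ₄ : ℝ, 0 < δ₄ → ∃ (α' r39 δ39 B39 a39 M39 a311 M311 : ℝ) (p q : PinPrims) (p3 q3 : PairPrims) (pM qM : MixedPrims)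
      (δ12₀ δK12 σ12 ρ12 a12 M12 B12₃ δ12₃ ρ13 α12 θ₂ ρf12 : ℝ) (Bq12 : ℝ → ℝ) (t12 δT12 ρS σS B13₄ : ℝ)
      (θV13 Br13 BhD13 Bx13 Bd13 : ℝ → ℝ) (Bd2₁₃ : ℝ → ℝ → ℝ) (tJ δB rT δ₂ : ℝ) (Bx0 BdX BiD : ℝ → ℝ) (a₀E δ₁E B₁E : ℝ),
      (0 < α') ∧ (α' < 1) ∧ (0 < r39) ∧ (r39 ≤ δ39) ∧ (0 < B39) ∧ (0 < a39) ∧ (0 < M39) ∧ (0 < a311) ∧ (0 < M311) ∧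
      p.OK ∧ q.OK ∧ p3.OK ∧ q3.OK ∧ pM.OK ∧ qM.OK ∧
      (nbrM₀Y d ℓ hd hL b₀ b₁ 2 ≤ Mstar) ∧ (nbrM₀Y d ℓ hd hL b₀ b₁ ((ℓ : ℝ) + 4) ≤ Mstar) ∧
      (0 ≤ θ₂) ∧ (0 < ρf12) ∧ (ρf12 + σ12 ≤ (1 - α12) * ρ12) ∧ (ρf12 + 2 * σ12 + α12 * ρ12 ≤ ρ12) ∧ (∀ β, 0 ≤ Bq12 β) ∧ (0 ≤ B12₃) ∧
      (0 < σ12) ∧ (0 < ρ12) ∧ (ρ12 ≤ δ12₀) ∧ (ρ12 + σ12 ≤ δK12) ∧ (ρ12 + σ12 ≤ δ12₃) ∧ (0 < a12) ∧ (0 < M12) ∧ (0 < α12) ∧ (α12 ≤ 1 / 2) ∧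
      (δ12₀ ≤ (1 - 3 * q.αF) * ((1 - 2 * q.α) * q.δ₀)) ∧
      (0 ≤ t12) ∧ (0 < σS) ∧ (ρS ≤ δT12) ∧ (ρS + σS ≤ δ12₀) ∧ (ρS + σS ≤ δ12₃) ∧ (δK12 + q.αF * ((1 - 2 * q.α) * q.δ₀) ≤ ρS) ∧
      (M311 ≤ M12) ∧ (a12 ≤ a311) ∧ (σS ≤ δK12) ∧ (0 < ρ13) ∧ (ρ13 + 5 * σ12 ≤ ρ12) ∧ (3 * σ12 < (1 - α12) * ρ13) ∧
      (∀ ε, 0 < ε → 0 ≤ θV13 ε) ∧ (0 ≤ B13₄) ∧ (∀ ε, 0 < ε → 0 ≤ Br13 ε) ∧ (∀ β, 0 ≤ β → β < 1 → 0 ≤ BhD13 β) ∧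
      (∀ β, 0 ≤ β → β < 1 → 0 ≤ Bx13 β) ∧ (∀ ε, 0 < ε → ε ≤ 1 → 0 ≤ Bd13 ε) ∧ (∀ ε β, 0 < ε → ε ≤ 1 → 0 ≤ β → β < 1 → 0 ≤ Bd2₁₃ ε β) ∧
      (0 ≤ tJ) ∧ (rT ≤ min ((1 - 2 * p.α) * p.δ₀) δ39 / 8) ∧ (rT ≤ δB) ∧ (0 ≤ δT12) ∧ (δT12 + 3 * σS + 3 * (q.αF * ((1 - 2 * q.α) * q.δ₀)) ≤ rT) ∧
      (∀ β, 0 ≤ β → β < 1 → 0 ≤ Bx0 β) ∧ (∀ β, 0 ≤ β → β < 1 → 0 ≤ BdX β) ∧ (∀ ε, 0 < ε → 0 ≤ BiD ε) ∧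
      (0 < a₀E) ∧ (0 < δ₁E) ∧ (0 < B₁E) ∧ (rT ≤ δ₄) ∧ (rT ≤ δ₂) := by
  -- `M⋆` FIRST (it does not depend on `δ₄`), then the scale `s := min 1 δ₄` of `numerics_inhabited_ed29`
  refine ⟨max (nbrM₀Y d ℓ hd hL b₀ b₁ 2) (nbrM₀Y d ℓ hd hL b₀ b₁ ((ℓ : ℝ) + 4)), fun δ₄ hδ₄ => ?_⟩
  set s : ℝ := min 1 δ₄ with hsdef
  have hs : 0 < s := lt_min one_pos hδ₄
  have hs4 : s ≤ δ₄ := min_le_right _ _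
  let pp : PinPrims :=
    { α := 1 / 4, ρ := 0, Nc := 0, N' := 0, NF := 0, Cℓ := 1, Kc := 0, θ₀ := 0, B₀ := 1, δ₀ := s, a₁ := 1, M₁ := 1, αF := 1 / 1000,
      NH := 0, NL := 0, BL := 0, NI := 0, N2 := 0, B2 := 0, θ2 := 0, Bl := fun _ => 0, Bt := fun _ => 0, BI := fun _ => 0, θI := fun _ => 0,
      BI2 := fun _ _ => 0 }
  have hpp : pp.OK :=
    { α_pos := by norm_num [pp], α_lt := by norm_num [pp], Nc_nn := le_rfl, N'_nn := le_rfl, NF_nn := le_rfl, one_le_Cℓ := le_rfl, Kc_nn := le_rfl,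
      θ₀_nn := le_rfl, B₀_pos := by norm_num [pp], δ₀_pos := hs, a₁_pos := by norm_num [pp], M₁_pos := by norm_num [pp],
      αF_pos := by norm_num [pp], αF_lt := by norm_num [pp], NH_nn := le_rfl, NL_nn := le_rfl, BL_nn := le_rfl, NI_nn := le_rfl, N2_nn := le_rfl,
      B2_nn := le_rfl, θ2_nn := le_rfl, Bl_nn := fun _ _ _ => le_rfl, Bt_nn := fun _ _ _ => le_rfl, BI_nn := fun _ _ _ => le_rfl,
      BI2_nn := fun _ _ _ _ _ _ => le_rfl, θI_nn := fun _ _ => le_rfl }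
  have hα : pp.α = 1 / 4 := rfl
  have hδ : pp.δ₀ = s := rfl
  have hF : pp.αF = 1 / 1000 := rfl
  refine ⟨1 / 2, s, s, 1, 1, 1, 1, 1, pp, pp, ⟨0, 0, 0⟩, ⟨0, 0, 0⟩, ⟨0, 0, 0⟩, ⟨0, 0, 0⟩,
    9 * s / 20, s / 50, s / 1000, s / 100, 1, 1, 0, s, s / 200, 1 / 8, 0, s / 1000, fun _ => 0, 0, s / 20, s / 25, s / 1000, 0,
    fun _ => 0, fun _ => 0, fun _ => 0, fun _ => 0, fun _ => 0, fun _ _ => 0, 0, s, s / 16, s / 16, fun _ => 0, fun _ => 0, fun _ => 0, 1, 1, 1,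
    by norm_num, by norm_num, hs, le_rfl, by norm_num, by norm_num, by norm_num, by norm_num, by norm_num,
    hpp, hpp, ⟨le_rfl, le_rfl, le_rfl⟩, ⟨le_rfl, le_rfl, le_rfl⟩, ⟨le_rfl, le_rfl, le_rfl⟩, ⟨le_rfl, le_rfl, le_rfl⟩,
    le_max_left _ _, le_max_right _ _,
    le_rfl, by positivity, by linarith, by linarith, fun _ => le_rfl, le_rfl,
    by positivity, by positivity, by linarith, by linarith, by linarith, by norm_num, by norm_num, by norm_num, by norm_num,
    ?_, le_rfl, by positivity, by linarith, by linarith, by linarith, ?_, le_rfl, le_rfl, by linarith, by positivity, by linarith, by linarith,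
    fun _ _ => le_rfl, le_rfl, fun _ _ => le_rfl, fun _ _ _ => le_rfl, fun _ _ _ => le_rfl, fun _ _ _ => le_rfl, fun _ _ _ _ _ _ => le_rfl,
    le_rfl, ?_, by linarith, by positivity, ?_, fun _ _ _ => le_rfl, fun _ _ _ => le_rfl, fun _ _ => le_rfl,
    by norm_num, by norm_num, by norm_num, by linarith, le_rfl⟩
  · rw [hF, hα, hδ]; linarith
  · rw [hF, hα, hδ]; linarith
  · rw [hα, hδ, min_eq_left (by linarith)]; linarith
  · rw [hF, hα, hδ]; linarith


/-- ★ **EDITION 33** (rows 18's mixed L² leg derived at dag-n06-w7's NAMED constants): the same pure-numeric hypotheses PLUS the five new side conditions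
`MMix ≤ p.M₁`, `p.a₁ ≤ aMix`, `BMix ≤ pM.BM`, `p.δ₀ ≤ δMix`, `walkCntY ≤ pM.NM` are jointly satisfiable for EVERY positive value of the named constants
(`MMix aMix BMix δMix` are `choose`-terms of `M⋆ N`; `walkCntY ≥ 0` a `choose`-term of `M⋆`) — hence the guard quantifies them universally AFTER `M⋆`, like `δ₄`:
`∃ M⋆, ∀ δ₄ > 0, ∀ MMx aMx BMx δMx > 0, ∀ W ≥ 0, ∃ rates …`.  Witness: edition 29M's with the scale `s := min 1 (min δ₄ δMx)`, `p.M₁ := max 1 MMx`, `p.a₁ := min 1 aMx`,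
`pM := ⟨W, BMx, 0⟩`.  Instantiate with `MMix … M⋆ N c35Y c35Y_pos`, …, `walkCntY … M⋆` (`MMix_pos … δMix_pos`, `walkCntY_nonneg`).
[cite: Balaban1985BackgroundPropagators, Thm 3.1 p.397, (3.46) p.398, Cor 3.6 p.408; Balaban1984PropagatorsII, Lemma 2.1 p.234, p.235] -/
theorem numerics_inhabited_ed33 (d ℓ : ℕ) (hd : 1 ≤ d + 1) (hL : Odd (ℓ + 1) ∧ 1 < ℓ + 1) (b₀ b₁ : ℝ) :
    ∃ Mstar : ℕ, ∀ δ₄ : ℝ, 0 < δ₄ → ∀ MMx aMx BMx δMx W : ℝ, 0 < MMx → 0 < aMx → 0 < BMx → 0 < δMx → 0 ≤ W → ∃ (α' r39 δ39 B39 a39 M39 a311 M311 : ℝ) (p q : PinPrims) (p3 q3 : PairPrims) (pM qM : MixedPrims)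
      (δ12₀ δK12 σ12 ρ12 a12 M12 B12₃ δ12₃ ρ13 α12 θ₂ ρf12 : ℝ) (Bq12 : ℝ → ℝ) (t12 δT12 ρS σS B13₄ : ℝ)
      (θV13 Br13 BhD13 Bx13 Bd13 : ℝ → ℝ) (Bd2₁₃ : ℝ → ℝ → ℝ) (tJ δB rT δ₂ : ℝ) (Bx0 BdX BiD : ℝ → ℝ) (a₀E δ₁E B₁E : ℝ),
      (0 < α') ∧ (α' < 1) ∧ (0 < r39) ∧ (r39 ≤ δ39) ∧ (0 < B39) ∧ (0 < a39) ∧ (0 < M39) ∧ (0 < a311) ∧ (0 < M311) ∧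
      p.OK ∧ q.OK ∧ p3.OK ∧ q3.OK ∧ pM.OK ∧ qM.OK ∧
      (nbrM₀Y d ℓ hd hL b₀ b₁ 2 ≤ Mstar) ∧ (nbrM₀Y d ℓ hd hL b₀ b₁ ((ℓ : ℝ) + 4) ≤ Mstar) ∧
      (0 ≤ θ₂) ∧ (0 < ρf12) ∧ (ρf12 + σ12 ≤ (1 - α12) * ρ12) ∧ (ρf12 + 2 * σ12 + α12 * ρ12 ≤ ρ12) ∧ (∀ β, 0 ≤ Bq12 β) ∧ (0 ≤ B12₃) ∧
      (0 < σ12) ∧ (0 < ρ12) ∧ (ρ12 ≤ δ12₀) ∧ (ρ12 + σ12 ≤ δK12) ∧ (ρ12 + σ12 ≤ δ12₃) ∧ (0 < a12) ∧ (0 < M12) ∧ (0 < α12) ∧ (α12 ≤ 1 / 2) ∧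
      (δ12₀ ≤ (1 - 3 * q.αF) * ((1 - 2 * q.α) * q.δ₀)) ∧
      (0 ≤ t12) ∧ (0 < σS) ∧ (ρS ≤ δT12) ∧ (ρS + σS ≤ δ12₀) ∧ (ρS + σS ≤ δ12₃) ∧ (δK12 + q.αF * ((1 - 2 * q.α) * q.δ₀) ≤ ρS) ∧
      (M311 ≤ M12) ∧ (a12 ≤ a311) ∧ (σS ≤ δK12) ∧ (0 < ρ13) ∧ (ρ13 + 5 * σ12 ≤ ρ12) ∧ (3 * σ12 < (1 - α12) * ρ13) ∧
      (∀ ε, 0 < ε → 0 ≤ θV13 ε) ∧ (0 ≤ B13₄) ∧ (∀ ε, 0 < ε → 0 ≤ Br13 ε) ∧ (∀ β, 0 ≤ β → β < 1 → 0 ≤ BhD13 β) ∧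
      (∀ β, 0 ≤ β → β < 1 → 0 ≤ Bx13 β) ∧ (∀ ε, 0 < ε → ε ≤ 1 → 0 ≤ Bd13 ε) ∧ (∀ ε β, 0 < ε → ε ≤ 1 → 0 ≤ β → β < 1 → 0 ≤ Bd2₁₃ ε β) ∧
      (0 ≤ tJ) ∧ (rT ≤ min ((1 - 2 * p.α) * p.δ₀) δ39 / 8) ∧ (rT ≤ δB) ∧ (0 ≤ δT12) ∧ (δT12 + 3 * σS + 3 * (q.αF * ((1 - 2 * q.α) * q.δ₀)) ≤ rT) ∧
      (∀ β, 0 ≤ β → β < 1 → 0 ≤ Bx0 β) ∧ (∀ β, 0 ≤ β → β < 1 → 0 ≤ BdX β) ∧ (∀ ε, 0 < ε → 0 ≤ BiD ε) ∧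
      (0 < a₀E) ∧ (0 < δ₁E) ∧ (0 < B₁E) ∧ (rT ≤ δ₄) ∧ (rT ≤ δ₂) ∧
      (MMx ≤ p.M₁) ∧ (p.a₁ ≤ aMx) ∧ (BMx ≤ pM.BM) ∧ (p.δ₀ ≤ δMx) ∧ (W ≤ pM.NM) := by
  -- `M⋆` FIRST (it does not depend on `δ₄`), then the scale `s := min 1 δ₄` of `numerics_inhabited_ed29`
  refine ⟨max (nbrM₀Y d ℓ hd hL b₀ b₁ 2) (nbrM₀Y d ℓ hd hL b₀ b₁ ((ℓ : ℝ) + 4)), fun δ₄ hδ₄ MMx aMx BMx δMx W hMMx haMx hBMx hδMx hW => ?_⟩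
  set s : ℝ := min 1 (min δ₄ δMx) with hsdef
  have hs : 0 < s := lt_min one_pos (lt_min hδ₄ hδMx)
  have hs4 : s ≤ δ₄ := (min_le_right _ _).trans (min_le_left _ _)
  have hsM : s ≤ δMx := (min_le_right _ _).trans (min_le_right _ _)
  let pp : PinPrims :=
    { α := 1 / 4, ρ := 0, Nc := 0, N' := 0, NF := 0, Cℓ := 1, Kc := 0, θ₀ := 0, B₀ := 1, δ₀ := s, a₁ := min 1 aMx, M₁ := max 1 MMx, αF := 1 / 1000,
      NH := 0, NL := 0, BL := 0, NI := 0, N2 := 0, B2 := 0, θ2 := 0, Bl := fun _ => 0, Bt := fun _ => 0, BI := fun _ => 0, θI := fun _ => 0,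
      BI2 := fun _ _ => 0 }
  have hpp : pp.OK :=
    { α_pos := by norm_num [pp], α_lt := by norm_num [pp], Nc_nn := le_rfl, N'_nn := le_rfl, NF_nn := le_rfl, one_le_Cℓ := le_rfl, Kc_nn := le_rfl,
      θ₀_nn := le_rfl, B₀_pos := by norm_num [pp], δ₀_pos := hs, a₁_pos := lt_min one_pos haMx, M₁_pos := lt_of_lt_of_le one_pos (le_max_left _ _),
      αF_pos := by norm_num [pp], αF_lt := by norm_num [pp], NH_nn := le_rfl, NL_nn := le_rfl, BL_nn := le_rfl, NI_nn := le_rfl, N2_nn := le_rfl,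
      B2_nn := le_rfl, θ2_nn := le_rfl, Bl_nn := fun _ _ _ => le_rfl, Bt_nn := fun _ _ _ => le_rfl, BI_nn := fun _ _ _ => le_rfl,
      BI2_nn := fun _ _ _ _ _ _ => le_rfl, θI_nn := fun _ _ => le_rfl }
  have hα : pp.α = 1 / 4 := rfl
  have hδ : pp.δ₀ = s := rfl
  have hF : pp.αF = 1 / 1000 := rfl
  refine ⟨1 / 2, s, s, 1, 1, 1, 1, 1, pp, pp, ⟨0, 0, 0⟩, ⟨0, 0, 0⟩, ⟨W, BMx, 0⟩, ⟨0, 0, 0⟩,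
    9 * s / 20, s / 50, s / 1000, s / 100, 1, 1, 0, s, s / 200, 1 / 8, 0, s / 1000, fun _ => 0, 0, s / 20, s / 25, s / 1000, 0,
    fun _ => 0, fun _ => 0, fun _ => 0, fun _ => 0, fun _ => 0, fun _ _ => 0, 0, s, s / 16, s / 16, fun _ => 0, fun _ => 0, fun _ => 0, 1, 1, 1,
    by norm_num, by norm_num, hs, le_rfl, by norm_num, by norm_num, by norm_num, by norm_num, by norm_num,
    hpp, hpp, ⟨le_rfl, le_rfl, le_rfl⟩, ⟨le_rfl, le_rfl, le_rfl⟩, ⟨hW, hBMx.le, le_rfl⟩, ⟨le_rfl, le_rfl, le_rfl⟩,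
    le_max_left _ _, le_max_right _ _,
    le_rfl, by positivity, by linarith, by linarith, fun _ => le_rfl, le_rfl,
    by positivity, by positivity, by linarith, by linarith, by linarith, by norm_num, by norm_num, by norm_num, by norm_num,
    ?_, le_rfl, by positivity, by linarith, by linarith, by linarith, ?_, le_rfl, le_rfl, by linarith, by positivity, by linarith, by linarith,
    fun _ _ => le_rfl, le_rfl, fun _ _ => le_rfl, fun _ _ _ => le_rfl, fun _ _ _ => le_rfl, fun _ _ _ => le_rfl, fun _ _ _ _ _ _ => le_rfl,
    le_rfl, ?_, by linarith, by positivity, ?_, fun _ _ _ => le_rfl, fun _ _ _ => le_rfl, fun _ _ => le_rfl,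
    by norm_num, by norm_num, by norm_num, by linarith, le_rfl,
    le_max_right _ _, min_le_right _ _, le_rfl, hsM, le_rfl⟩
  · rw [hF, hα, hδ]; linarith
  · rw [hF, hα, hδ]; linarith
  · rw [hα, hδ, min_eq_left (by linarith)]; linarith
  · rw [hF, hα, hδ]; linarith


/-- ★ **EDITION 37** (rows 20–21's W-c faces `hdiv` ∕ `hLHH` derived, editions 36∕37): the pure-numeric hypotheses of edition 33 WITHOUT the sign of the gone function binder
`BiD` (edition 36) PLUS the one new rate inequality `δ12₃ ≤ δ12₀` (edition 37's `hδ₃₀`: a Hölder probe of `∇_U G₀ Q*` — dag-n06-w5 `lettersHHZ_pins` ∕ dag-n06-l `pQ_of_h43` —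
decays no faster than Theorem 3.3's rate `δ12₀` for `G₀`; print-intrinsic) are JOINTLY SATISFIABLE: the edition-33 witness with `δ12₃` LOWERED from `s` to `9s∕20 = δ12₀`
(its other constraints are the lower bounds `ρ12 + σ12 ≤ δ12₃`, `ρS + σS ≤ δ12₃`, both `≤ 0.041·s`).  Quantifier order as in `numerics_inhabited_ed33` (`∃ M⋆, ∀ δ₄ > 0, ∀ MMx aMx BMx
δMx > 0, ∀ W ≥ 0, ∃ …`).  [cite: Balaban1985BackgroundPropagators, Thm 3.12 p.423 + (3.43) p.398 + (3.126) p.420 + Thms 3.1–3.15 pp.397–432 (the displayed rate∕threshold side conditions); Balaban1984PropagatorsII, Lemma 2.1 (2.60)–(2.61) p.234 (bookkeeping)] -/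
theorem numerics_inhabited_ed37 (d ℓ : ℕ) (hd : 1 ≤ d + 1) (hL : Odd (ℓ + 1) ∧ 1 < ℓ + 1) (b₀ b₁ : ℝ) :
    ∃ Mstar : ℕ, ∀ δ₄ : ℝ, 0 < δ₄ → ∀ MMx aMx BMx δMx W : ℝ, 0 < MMx → 0 < aMx → 0 < BMx → 0 < δMx → 0 ≤ W → ∃ (α' r39 δ39 B39 a39 M39 a311 M311 : ℝ) (p q : PinPrims) (p3 q3 : PairPrims) (pM qM : MixedPrims)
      (δ12₀ δK12 σ12 ρ12 a12 M12 B12₃ δ12₃ ρ13 α12 θ₂ ρf12 : ℝ) (Bq12 : ℝ → ℝ) (t12 δT12 ρS σS B13₄ : ℝ)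
      (θV13 Br13 BhD13 Bx13 Bd13 : ℝ → ℝ) (Bd2₁₃ : ℝ → ℝ → ℝ) (tJ δB rT δ₂ : ℝ) (Bx0 BdX : ℝ → ℝ) (a₀E δ₁E B₁E : ℝ),
      (0 < α') ∧ (α' < 1) ∧ (0 < r39) ∧ (r39 ≤ δ39) ∧ (0 < B39) ∧ (0 < a39) ∧ (0 < M39) ∧ (0 < a311) ∧ (0 < M311) ∧
      p.OK ∧ q.OK ∧ p3.OK ∧ q3.OK ∧ pM.OK ∧ qM.OK ∧
      (nbrM₀Y d ℓ hd hL b₀ b₁ 2 ≤ Mstar) ∧ (nbrM₀Y d ℓ hd hL b₀ b₁ ((ℓ : ℝ) + 4) ≤ Mstar) ∧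
      (0 ≤ θ₂) ∧ (0 < ρf12) ∧ (ρf12 + σ12 ≤ (1 - α12) * ρ12) ∧ (ρf12 + 2 * σ12 + α12 * ρ12 ≤ ρ12) ∧ (∀ β, 0 ≤ Bq12 β) ∧ (0 ≤ B12₃) ∧
      (0 < σ12) ∧ (0 < ρ12) ∧ (ρ12 ≤ δ12₀) ∧ (ρ12 + σ12 ≤ δK12) ∧ (ρ12 + σ12 ≤ δ12₃) ∧ (0 < a12) ∧ (0 < M12) ∧ (0 < α12) ∧ (α12 ≤ 1 / 2) ∧ (δ12₃ ≤ δ12₀) ∧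
      (δ12₀ ≤ (1 - 3 * q.αF) * ((1 - 2 * q.α) * q.δ₀)) ∧
      (0 ≤ t12) ∧ (0 < σS) ∧ (ρS ≤ δT12) ∧ (ρS + σS ≤ δ12₀) ∧ (ρS + σS ≤ δ12₃) ∧ (δK12 + q.αF * ((1 - 2 * q.α) * q.δ₀) ≤ ρS) ∧
      (M311 ≤ M12) ∧ (a12 ≤ a311) ∧ (σS ≤ δK12) ∧ (0 < ρ13) ∧ (ρ13 + 5 * σ12 ≤ ρ12) ∧ (3 * σ12 < (1 - α12) * ρ13) ∧
      (∀ ε, 0 < ε → 0 ≤ θV13 ε) ∧ (0 ≤ B13₄) ∧ (∀ ε, 0 < ε → 0 ≤ Br13 ε) ∧ (∀ β, 0 ≤ β → β < 1 → 0 ≤ BhD13 β) ∧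
      (∀ β, 0 ≤ β → β < 1 → 0 ≤ Bx13 β) ∧ (∀ ε, 0 < ε → ε ≤ 1 → 0 ≤ Bd13 ε) ∧ (∀ ε β, 0 < ε → ε ≤ 1 → 0 ≤ β → β < 1 → 0 ≤ Bd2₁₃ ε β) ∧
      (0 ≤ tJ) ∧ (rT ≤ min ((1 - 2 * p.α) * p.δ₀) δ39 / 8) ∧ (rT ≤ δB) ∧ (0 ≤ δT12) ∧ (δT12 + 3 * σS + 3 * (q.αF * ((1 - 2 * q.α) * q.δ₀)) ≤ rT) ∧
      (∀ β, 0 ≤ β → β < 1 → 0 ≤ Bx0 β) ∧ (∀ β, 0 ≤ β → β < 1 → 0 ≤ BdX β) ∧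
      (0 < a₀E) ∧ (0 < δ₁E) ∧ (0 < B₁E) ∧ (rT ≤ δ₄) ∧ (rT ≤ δ₂) ∧
      (MMx ≤ p.M₁) ∧ (p.a₁ ≤ aMx) ∧ (BMx ≤ pM.BM) ∧ (p.δ₀ ≤ δMx) ∧ (W ≤ pM.NM) := by
  -- as `numerics_inhabited_ed33`, with `δ12₃ := 9s∕20 = δ12₀` (edition 37's `hδ₃₀ : δ12₃ ≤ δ12₀`) and no `BiD` (edition 36)
  refine ⟨max (nbrM₀Y d ℓ hd hL b₀ b₁ 2) (nbrM₀Y d ℓ hd hL b₀ b₁ ((ℓ : ℝ) + 4)), fun δ₄ hδ₄ MMx aMx BMx δMx W hMMx haMx hBMx hδMx hW => ?_⟩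
  set s : ℝ := min 1 (min δ₄ δMx) with hsdef
  have hs : 0 < s := lt_min one_pos (lt_min hδ₄ hδMx)
  have hs4 : s ≤ δ₄ := (min_le_right _ _).trans (min_le_left _ _)
  have hsM : s ≤ δMx := (min_le_right _ _).trans (min_le_right _ _)
  let pp : PinPrims :=
    { α := 1 / 4, ρ := 0, Nc := 0, N' := 0, NF := 0, Cℓ := 1, Kc := 0, θ₀ := 0, B₀ := 1, δ₀ := s, a₁ := min 1 aMx, M₁ := max 1 MMx, αF := 1 / 1000,
      NH := 0, NL := 0, BL := 0, NI := 0, N2 := 0, B2 := 0, θ2 := 0, Bl := fun _ => 0, Bt := fun _ => 0, BI := fun _ => 0, θI := fun _ => 0,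
      BI2 := fun _ _ => 0 }
  have hpp : pp.OK :=
    { α_pos := by norm_num [pp], α_lt := by norm_num [pp], Nc_nn := le_rfl, N'_nn := le_rfl, NF_nn := le_rfl, one_le_Cℓ := le_rfl, Kc_nn := le_rfl,
      θ₀_nn := le_rfl, B₀_pos := by norm_num [pp], δ₀_pos := hs, a₁_pos := lt_min one_pos haMx, M₁_pos := lt_of_lt_of_le one_pos (le_max_left _ _),
      αF_pos := by norm_num [pp], αF_lt := by norm_num [pp], NH_nn := le_rfl, NL_nn := le_rfl, BL_nn := le_rfl, NI_nn := le_rfl, N2_nn := le_rfl,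
      B2_nn := le_rfl, θ2_nn := le_rfl, Bl_nn := fun _ _ _ => le_rfl, Bt_nn := fun _ _ _ => le_rfl, BI_nn := fun _ _ _ => le_rfl,
      BI2_nn := fun _ _ _ _ _ _ => le_rfl, θI_nn := fun _ _ => le_rfl }
  have hα : pp.α = 1 / 4 := rfl
  have hδ : pp.δ₀ = s := rfl
  have hF : pp.αF = 1 / 1000 := rfl
  refine ⟨1 / 2, s, s, 1, 1, 1, 1, 1, pp, pp, ⟨0, 0, 0⟩, ⟨0, 0, 0⟩, ⟨W, BMx, 0⟩, ⟨0, 0, 0⟩,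
    9 * s / 20, s / 50, s / 1000, s / 100, 1, 1, 0, 9 * s / 20, s / 200, 1 / 8, 0, s / 1000, fun _ => 0, 0, s / 20, s / 25, s / 1000, 0,
    fun _ => 0, fun _ => 0, fun _ => 0, fun _ => 0, fun _ => 0, fun _ _ => 0, 0, s, s / 16, s / 16, fun _ => 0, fun _ => 0, 1, 1, 1,
    by norm_num, by norm_num, hs, le_rfl, by norm_num, by norm_num, by norm_num, by norm_num, by norm_num,
    hpp, hpp, ⟨le_rfl, le_rfl, le_rfl⟩, ⟨le_rfl, le_rfl, le_rfl⟩, ⟨hW, hBMx.le, le_rfl⟩, ⟨le_rfl, le_rfl, le_rfl⟩,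
    le_max_left _ _, le_max_right _ _,
    le_rfl, by positivity, by linarith, by linarith, fun _ => le_rfl, le_rfl,
    by positivity, by positivity, by linarith, by linarith, by linarith, by norm_num, by norm_num, by norm_num, by norm_num, le_rfl,
    ?_, le_rfl, by positivity, by linarith, by linarith, by linarith, ?_, le_rfl, le_rfl, by linarith, by positivity, by linarith, by linarith,
    fun _ _ => le_rfl, le_rfl, fun _ _ => le_rfl, fun _ _ _ => le_rfl, fun _ _ _ => le_rfl, fun _ _ _ => le_rfl, fun _ _ _ _ _ _ => le_rfl,
    le_rfl, ?_, by linarith, by positivity, ?_, fun _ _ _ => le_rfl, fun _ _ _ => le_rfl,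
    by norm_num, by norm_num, by norm_num, by linarith, le_rfl,
    le_max_right _ _, min_le_right _ _, le_rfl, hsM, le_rfl⟩
  · rw [hF, hα, hδ]; linarith
  · rw [hF, hα, hδ]; linarith
  · rw [hα, hδ, min_eq_left (by linarith)]; linarith
  · rw [hF, hα, hδ]; linarith


/-- ★ **EDITION 39** (the re-cut block-L² letters `vDRDG ∕ vGDRD` derived at the T-step rate): the pure-numeric hypotheses of edition 37 PLUS the one new rate inequality
`δ12₃ ≤ (1 − 2·q.αF)·rT − σS` (edition 39's `hδ₃T`: the (3.152)-cut letters D·R·D\*·G₁ ∕ G₁·D·R·D\* decay at the rate of the member facts used for them, here the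
T-step rate `rT`, minus the (2.61) margin and twice the (2.60) exponent; print-intrinsic) are JOINTLY SATISFIABLE: the edition-37 witness with `δ12₃` lowered from `9s∕20` to
`s∕20` (`rT = s∕16`, `σS = s∕1000`, `α_F = 10⁻³`: `(1 − 2·10⁻³)·s∕16 − s∕1000 ≈ 0.0614·s ≥ 0.05·s`; the lower bounds `ρ12 + σ12 = 0.011·s`, `ρS + σS = 0.041·s` still hold).
[cite: Balaban1985BackgroundPropagators, Thm 3.13 p.426 + (3.152) p.426 + Thm 3.12 p.423 + Thms 3.1–3.15 pp.397–432 (the displayed rate∕threshold side conditions); Balaban1984PropagatorsII, Lemma 2.1 (2.60)–(2.61) p.234 (bookkeeping)] -/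
theorem numerics_inhabited_ed39 (d ℓ : ℕ) (hd : 1 ≤ d + 1) (hL : Odd (ℓ + 1) ∧ 1 < ℓ + 1) (b₀ b₁ : ℝ) :
    ∃ Mstar : ℕ, ∀ δ₄ : ℝ, 0 < δ₄ → ∀ MMx aMx BMx δMx W : ℝ, 0 < MMx → 0 < aMx → 0 < BMx → 0 < δMx → 0 ≤ W → ∃ (α' r39 δ39 B39 a39 M39 a311 M311 : ℝ) (p q : PinPrims) (p3 q3 : PairPrims) (pM qM : MixedPrims)
      (δ12₀ δK12 σ12 ρ12 a12 M12 B12₃ δ12₃ ρ13 α12 θ₂ ρf12 : ℝ) (Bq12 : ℝ → ℝ) (t12 δT12 ρS σS B13₄ : ℝ)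
      (θV13 Br13 BhD13 Bx13 Bd13 : ℝ → ℝ) (Bd2₁₃ : ℝ → ℝ → ℝ) (tJ δB rT δ₂ : ℝ) (Bx0 BdX : ℝ → ℝ) (a₀E δ₁E B₁E : ℝ),
      (0 < α') ∧ (α' < 1) ∧ (0 < r39) ∧ (r39 ≤ δ39) ∧ (0 < B39) ∧ (0 < a39) ∧ (0 < M39) ∧ (0 < a311) ∧ (0 < M311) ∧
      p.OK ∧ q.OK ∧ p3.OK ∧ q3.OK ∧ pM.OK ∧ qM.OK ∧
      (nbrM₀Y d ℓ hd hL b₀ b₁ 2 ≤ Mstar) ∧ (nbrM₀Y d ℓ hd hL b₀ b₁ ((ℓ : ℝ) + 4) ≤ Mstar) ∧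
      (0 ≤ θ₂) ∧ (0 < ρf12) ∧ (ρf12 + σ12 ≤ (1 - α12) * ρ12) ∧ (ρf12 + 2 * σ12 + α12 * ρ12 ≤ ρ12) ∧ (∀ β, 0 ≤ Bq12 β) ∧ (0 ≤ B12₃) ∧
      (0 < σ12) ∧ (0 < ρ12) ∧ (ρ12 ≤ δ12₀) ∧ (ρ12 + σ12 ≤ δK12) ∧ (ρ12 + σ12 ≤ δ12₃) ∧ (0 < a12) ∧ (0 < M12) ∧ (0 < α12) ∧ (α12 ≤ 1 / 2) ∧ (δ12₃ ≤ δ12₀) ∧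
      (δ12₀ ≤ (1 - 3 * q.αF) * ((1 - 2 * q.α) * q.δ₀)) ∧
      (0 ≤ t12) ∧ (0 < σS) ∧ (ρS ≤ δT12) ∧ (ρS + σS ≤ δ12₀) ∧ (ρS + σS ≤ δ12₃) ∧ (δK12 + q.αF * ((1 - 2 * q.α) * q.δ₀) ≤ ρS) ∧
      (M311 ≤ M12) ∧ (a12 ≤ a311) ∧ (σS ≤ δK12) ∧ (0 < ρ13) ∧ (ρ13 + 5 * σ12 ≤ ρ12) ∧ (3 * σ12 < (1 - α12) * ρ13) ∧
      (∀ ε, 0 < ε → 0 ≤ θV13 ε) ∧ (0 ≤ B13₄) ∧ (∀ ε, 0 < ε → 0 ≤ Br13 ε) ∧ (∀ β, 0 ≤ β → β < 1 → 0 ≤ BhD13 β) ∧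
      (∀ β, 0 ≤ β → β < 1 → 0 ≤ Bx13 β) ∧ (∀ ε, 0 < ε → ε ≤ 1 → 0 ≤ Bd13 ε) ∧ (∀ ε β, 0 < ε → ε ≤ 1 → 0 ≤ β → β < 1 → 0 ≤ Bd2₁₃ ε β) ∧
      (0 ≤ tJ) ∧ (rT ≤ min ((1 - 2 * p.α) * p.δ₀) δ39 / 8) ∧ (rT ≤ δB) ∧ (0 ≤ δT12) ∧ (δT12 + 3 * σS + 3 * (q.αF * ((1 - 2 * q.α) * q.δ₀)) ≤ rT) ∧
      (∀ β, 0 ≤ β → β < 1 → 0 ≤ Bx0 β) ∧ (∀ β, 0 ≤ β → β < 1 → 0 ≤ BdX β) ∧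
      (0 < a₀E) ∧ (0 < δ₁E) ∧ (0 < B₁E) ∧ (rT ≤ δ₄) ∧ (rT ≤ δ₂) ∧ (δ12₃ ≤ (1 - 2 * q.αF) * rT - σS) ∧
      (MMx ≤ p.M₁) ∧ (p.a₁ ≤ aMx) ∧ (BMx ≤ pM.BM) ∧ (p.δ₀ ≤ δMx) ∧ (W ≤ pM.NM) := by
  -- as `numerics_inhabited_ed37`, with `δ12₃` LOWERED to `s∕20` (edition 39's `hδ₃T : δ12₃ ≤ (1 − 2α_F)·rT − σS`, rT = s∕16)
  refine ⟨max (nbrM₀Y d ℓ hd hL b₀ b₁ 2) (nbrM₀Y d ℓ hd hL b₀ b₁ ((ℓ : ℝ) + 4)), fun δ₄ hδ₄ MMx aMx BMx δMx W hMMx haMx hBMx hδMx hW => ?_⟩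
  set s : ℝ := min 1 (min δ₄ δMx) with hsdef
  have hs : 0 < s := lt_min one_pos (lt_min hδ₄ hδMx)
  have hs4 : s ≤ δ₄ := (min_le_right _ _).trans (min_le_left _ _)
  have hsM : s ≤ δMx := (min_le_right _ _).trans (min_le_right _ _)
  let pp : PinPrims :=
    { α := 1 / 4, ρ := 0, Nc := 0, N' := 0, NF := 0, Cℓ := 1, Kc := 0, θ₀ := 0, B₀ := 1, δ₀ := s, a₁ := min 1 aMx, M₁ := max 1 MMx, αF := 1 / 1000,
      NH := 0, NL := 0, BL := 0, NI := 0, N2 := 0, B2 := 0, θ2 := 0, Bl := fun _ => 0, Bt := fun _ => 0, BI := fun _ => 0, θI := fun _ => 0,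
      BI2 := fun _ _ => 0 }
  have hpp : pp.OK :=
    { α_pos := by norm_num [pp], α_lt := by norm_num [pp], Nc_nn := le_rfl, N'_nn := le_rfl, NF_nn := le_rfl, one_le_Cℓ := le_rfl, Kc_nn := le_rfl,
      θ₀_nn := le_rfl, B₀_pos := by norm_num [pp], δ₀_pos := hs, a₁_pos := lt_min one_pos haMx, M₁_pos := lt_of_lt_of_le one_pos (le_max_left _ _),
      αF_pos := by norm_num [pp], αF_lt := by norm_num [pp], NH_nn := le_rfl, NL_nn := le_rfl, BL_nn := le_rfl, NI_nn := le_rfl, N2_nn := le_rfl,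
      B2_nn := le_rfl, θ2_nn := le_rfl, Bl_nn := fun _ _ _ => le_rfl, Bt_nn := fun _ _ _ => le_rfl, BI_nn := fun _ _ _ => le_rfl,
      BI2_nn := fun _ _ _ _ _ _ => le_rfl, θI_nn := fun _ _ => le_rfl }
  have hα : pp.α = 1 / 4 := rfl
  have hδ : pp.δ₀ = s := rfl
  have hF : pp.αF = 1 / 1000 := rfl
  refine ⟨1 / 2, s, s, 1, 1, 1, 1, 1, pp, pp, ⟨0, 0, 0⟩, ⟨0, 0, 0⟩, ⟨W, BMx, 0⟩, ⟨0, 0, 0⟩,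
    9 * s / 20, s / 50, s / 1000, s / 100, 1, 1, 0, s / 20, s / 200, 1 / 8, 0, s / 1000, fun _ => 0, 0, s / 20, s / 25, s / 1000, 0,
    fun _ => 0, fun _ => 0, fun _ => 0, fun _ => 0, fun _ => 0, fun _ _ => 0, 0, s, s / 16, s / 16, fun _ => 0, fun _ => 0, 1, 1, 1,
    by norm_num, by norm_num, hs, le_rfl, by norm_num, by norm_num, by norm_num, by norm_num, by norm_num,
    hpp, hpp, ⟨le_rfl, le_rfl, le_rfl⟩, ⟨le_rfl, le_rfl, le_rfl⟩, ⟨hW, hBMx.le, le_rfl⟩, ⟨le_rfl, le_rfl, le_rfl⟩,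
    le_max_left _ _, le_max_right _ _,
    le_rfl, by positivity, by linarith, by linarith, fun _ => le_rfl, le_rfl,
    by positivity, by positivity, by linarith, by linarith, by linarith, by norm_num, by norm_num, by norm_num, by norm_num, by linarith,
    ?_, le_rfl, by positivity, by linarith, by linarith, by linarith, ?_, le_rfl, le_rfl, by linarith, by positivity, by linarith, by linarith,
    fun _ _ => le_rfl, le_rfl, fun _ _ => le_rfl, fun _ _ _ => le_rfl, fun _ _ _ => le_rfl, fun _ _ _ => le_rfl, fun _ _ _ _ _ _ => le_rfl,
    le_rfl, ?_, by linarith, by positivity, ?_, fun _ _ _ => le_rfl, fun _ _ _ => le_rfl,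
    by norm_num, by norm_num, by norm_num, by linarith, le_rfl, ?_,
    le_max_right _ _, min_le_right _ _, le_rfl, hsM, le_rfl⟩
  · rw [hF, hα, hδ]; linarith
  · rw [hF, hα, hδ]; linarith
  · rw [hα, hδ, min_eq_left (by linarith)]; linarith
  · rw [hF, hα, hδ]; linarith
  · rw [hF]; linarith

end Summit.QuantumFields.YangMills.BalabanUVNodes.N06NumericsWitness

end
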